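import Literature.AlgebraicGeometry.Motives.HodgeStructureQuotient
import Literature.AlgebraicGeometry.Motives.MixedHodgeStructureDual
import HarnessLib

/-!
# The graded pieces of the dual mixed Hodge structure: `Gr^W_r(H^∨) ≅ (Gr^W_{-r} H)^∨`

For a mixed `ℚ`-Hodge structure `H` on a finite-dimensional `V`, the dual MHS `H^∨`
(`MixedHodgeStructure.dual`, `Motives/MixedHodgeStructureDual.lean`: `W_r(H^∨) = (W_{-r-1} H)^⊥`,
`F^p(H^∨) = (F^{1-p} H)^⊥`; Fujiki 1980 (1.6.2) a), Deligne *Hodge II* 1.1.6–1.1.7, Cattani–El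
Zein–Griffiths–Lê §3.2.2.7) has graded pieces
`Gr^W_r(H^∨) = (W_{-r-1})^⊥ / (W_{-r})^⊥ ≅ (W_{-r} / W_{-r-1})^∨ = (Gr^W_{-r} H)^∨`,
and this canonical isomorphism `[φ] ↦ ([w] ↦ φ(w))` is an isomorphism of Hodge structures of weight
`r` onto the dual (`HodgeStructure.dual`, weight `-(-r)`) of the pure Hodge structure `Gr^W_{-r} H`
— El Zein, *Mixed Hodge structures* (1983), §II.0.2: for the dual filtration on `H = Hom(K, K')`
with `K'` trivially filtered, "`Gr^W_r H ≃ Hom(Gr^W_{-r} K, K')`".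

## Main results (all proved; no named facts)

* `MixedHodgeStructure.dualGrMap H r : Gr^W_r(H^∨) →ₗ[ℚ] (Gr^W_{-r} H)^∨`, `[φ] ↦ ([w] ↦ φ w)`
  (`dualGrMap_mk_mk`), and `dualGrMap_bijective`.
* `dualBaseChange_dualGrMap_baseChange` — compatibility of `dualGrMap` with the pairings
  `ℂ ⊗ V^∨ × ℂ ⊗ V → ℂ` and `ℂ ⊗ (Gr_{-r})^∨ × ℂ ⊗ Gr_{-r} → ℂ` (`dualBaseChange`).
* **`MixedHodgeStructure.dualGrHom H r : Hom (H^∨.gr r) (((H.gr (-r)).dual).cast _)`** — the map is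
  a morphism of Hodge structures, and `dualGrHom_bijective`; hence (`HodgeStructure.Hom.inverse`,
  `Hom.hodgeNumber_eq_of_bijective`) an isomorphism of Hodge structures:
  `gr_dual_hodgeNumber` — `h^{p,q}(Gr^W_r H^∨) = h^{p,q}((Gr^W_{-r} H)^∨)`.

## References

* [Elzein1983] F. El Zein, Mixed Hodge structures, Trans. AMS 275 (1983), §II.0.1–II.0.2 (dual
  filtrations on `Hom(K, K')`; `Gr^W_r Hom(K, K') ≃ Hom(Gr^W_{-r} K, K')`).
* [Fujiki1980] A. Fujiki, Duality of mixed Hodge structures of algebraic varieties, Publ. RIMS 16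
  (1980), (1.6.2) a).
* [DeligneHodgeII1971] P. Deligne, Théorie de Hodge II, 1.1.6–1.1.7, 1.1.11.
* [CattaniElZeinGriffithsLe2014] E. Cattani et al. (eds.), *Hodge Theory* (2014), §3.2.2.7.
-/

noncomputable section

open scoped TensorProduct

namespace Literature.AlgebraicGeometry.Motives

namespace MixedHodgeStructure

universe u

variable {V : Type u} [AddCommGroup V] [Module ℚ V]

open Module
open HodgeStructure (conj complexConj dualBaseChange dualBaseChange_tmul_tmul)

variable (H : MixedHodgeStructure V)

/-! ### The linear isomorphism `Gr^W_r(V^∨) ≅ (Gr^W_{-r} V)^∨` -/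

section Linear

variable [FiniteDimensional ℚ V]

/-- Restriction `W_r(V^∨) = (W_{-r-1})^⊥ → (Gr^W_{-r} V)^∨ = (W_{-r}/W_{-r-1})^∨`, `φ ↦ ([w] ↦ φ w)`:
restrict `φ` to `W_{-r}`; it kills `W_{-r-1} ∩ W_{-r}`, so descends to the quotient
(Mathlib's `Submodule.dualCopairing`). [cite: Elzein1983, §II.0.2] -/
def dualGrLift (r : ℤ) : ↥(H.dual.W r) →ₗ[ℚ] Module.Dual ℚ (grW H.W (-r)) :=
  (subPiece H.W (-r)).dualCopairing ∘ₗ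
    LinearMap.codRestrict ((subPiece H.W (-r)).dualAnnihilator)
      ((H.W (-r)).subtype.dualMap ∘ₗ (H.dual.W r).subtype) fun φ => by
        rw [Submodule.mem_dualAnnihilator]
        intro w hw
        rw [LinearMap.comp_apply, Submodule.subtype_apply, LinearMap.dualMap_apply, Submodule.subtype_apply]
        exact (Submodule.mem_dualAnnihilator _).1 φ.2 _ hw

/-- `dualGrLift φ [w] = φ w`. [cite: Elzein1983, §II.0.2] -/
@[simp]
theorem dualGrLift_mk (r : ℤ) (φ : H.dual.W r) (w : H.W (-r)) :
    H.dualGrLift r φ (Submodule.Quotient.mk w) = (φ : Module.Dual ℚ V) w := by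
  simp only [dualGrLift, LinearMap.comp_apply]
  rw [Submodule.dualCopairing_apply]
  rfl

/-- **The canonical map `Gr^W_r(V^∨) → (Gr^W_{-r} V)^∨`, `[φ] ↦ ([w] ↦ φ w)`**
(`W_r(V^∨) = (W_{-r-1})^⊥`; a form in `W_{r-1}(V^∨) = (W_{-r})^⊥` restricts to zero on `W_{-r}`).
El Zein 1983, §II.0.2: `Gr^W_r Hom(K, K') ≃ Hom(Gr^W_{-r} K, K')`. [cite: Elzein1983, §II.0.2] -/
def dualGrMap (r : ℤ) : grW H.dual.W r →ₗ[ℚ] Module.Dual ℚ (grW H.W (-r)) :=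
  (subPiece H.dual.W r).liftQ (H.dualGrLift r) fun φ hφ => by
    rw [LinearMap.mem_ker]
    refine LinearMap.ext fun x => ?_
    induction x using Submodule.Quotient.induction_on with
    | _ w =>
      rw [dualGrLift_mk, LinearMap.zero_apply]
      have hφ' : (φ : Module.Dual ℚ V) ∈ H.dual.W (r - 1) := hφ
      rw [dual_W, show -(r - 1) - 1 = -r by ring, Submodule.mem_dualAnnihilator] at hφ'
      exact hφ' _ w.2

/-- `dualGrMap [φ] [w] = φ w`. [cite: Elzein1983, §II.0.2] -/
@[simp]
theorem dualGrMap_mk_mk (r : ℤ) (φ : H.dual.W r) (w : H.W (-r)) :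
    H.dualGrMap r (Submodule.Quotient.mk φ) (Submodule.Quotient.mk w) = (φ : Module.Dual ℚ V) w := by
  rw [dualGrMap, Submodule.liftQ_apply, dualGrLift_mk]

/-- `Gr^W_r(V^∨) → (Gr^W_{-r} V)^∨` is injective: a form in `(W_{-r-1})^⊥` vanishing on `W_{-r}` lies in
`(W_{-r})^⊥ = W_{r-1}(V^∨)`. [cite: Elzein1983, §II.0.2] -/
theorem dualGrMap_injective (r : ℤ) : Function.Injective (H.dualGrMap r) := by
  rw [← LinearMap.ker_eq_bot, eq_bot_iff]
  intro x hx
  induction x using Submodule.Quotient.induction_on with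
  | _ φ =>
    rw [LinearMap.mem_ker] at hx
    rw [Submodule.mem_bot, Submodule.Quotient.mk_eq_zero]
    change (φ : Module.Dual ℚ V) ∈ H.dual.W (r - 1)
    rw [dual_W, show -(r - 1) - 1 = -r by ring, Submodule.mem_dualAnnihilator]
    intro w hw
    have h := LinearMap.congr_fun hx (Submodule.Quotient.mk ⟨w, hw⟩)
    rwa [dualGrMap_mk_mk, LinearMap.zero_apply] at h

/-- `Gr^W_r(V^∨) → (Gr^W_{-r} V)^∨` is surjective: a form on `W_{-r}` vanishing on `W_{-r-1}` extends
to a form on `V` vanishing on `W_{-r-1}` (`Subspace.dualLift`). [cite: Elzein1983, §II.0.2] -/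
theorem dualGrMap_surjective (r : ℤ) : Function.Surjective (H.dualGrMap r) := by
  intro ψ
  let ψ' : Module.Dual ℚ ↥(H.W (-r)) := ψ ∘ₗ (subPiece H.W (-r)).mkQ
  have hφ : Subspace.dualLift (H.W (-r)) ψ' ∈ H.dual.W r := by
    rw [dual_W, Submodule.mem_dualAnnihilator]
    intro v hv
    have hv' : v ∈ H.W (-r) := H.monotone_W (show -r - 1 ≤ -r by omega) hv
    rw [Subspace.dualLift_of_mem hv']
    show ψ (Submodule.Quotient.mk ⟨v, hv'⟩) = 0
    rw [(Submodule.Quotient.mk_eq_zero _).2 (show (⟨v, hv'⟩ : H.W (-r)) ∈ subPiece H.W (-r) from hv),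
      map_zero]
  refine ⟨Submodule.Quotient.mk ⟨_, hφ⟩, LinearMap.ext fun x => ?_⟩
  induction x using Submodule.Quotient.induction_on with
  | _ w =>
    rw [dualGrMap_mk_mk, Subspace.dualLift_of_subtype]
    rfl

/-- **`Gr^W_r(V^∨) ≅ (Gr^W_{-r} V)^∨`** (as vector spaces). [cite: Elzein1983, §II.0.2] -/
theorem dualGrMap_bijective (r : ℤ) : Function.Bijective (H.dualGrMap r) :=
  ⟨H.dualGrMap_injective r, H.dualGrMap_surjective r⟩

/-- **Compatibility with the complexified pairings**: for `η ∈ ℂ ⊗ W_r(V^∨)` and `z ∈ ℂ ⊗ W_{-r}`,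
`⟨(dualGrMap)_ℂ [η], [z]⟩ = ⟨η, z⟩`, the pairings being `dualBaseChange` of `Gr^W_{-r} V` and of `V`
(on pure tensors both sides are `c d φ(w)`). [cite: Elzein1983, §II.0.2] -/
theorem dualBaseChange_dualGrMap_baseChange (r : ℤ) (η : ℂ ⊗[ℚ] ↥(H.dual.W r))
    (z : ℂ ⊗[ℚ] ↥(H.W (-r))) :
    dualBaseChange (grW H.W (-r)) ((H.dualGrMap r).baseChange ℂ (grProj H.dual.W r η))
        (grProj H.W (-r) z) =
      dualBaseChange V (grIncl H.dual.W r η) (grIncl H.W (-r) z) := by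
  induction η using TensorProduct.induction_on with
  | zero => simp only [map_zero, LinearMap.zero_apply]
  | tmul c φ =>
    induction z using TensorProduct.induction_on with
    | zero => simp only [map_zero]
    | tmul d w =>
      simp only [grProj, grIncl, LinearMap.baseChange_tmul, Submodule.mkQ_apply, Submodule.subtype_apply,
        dualBaseChange_tmul_tmul, dualGrMap_mk_mk]
    | add x y hx hy => rw [map_add, map_add, map_add, map_add, hx, hy]
  | add η θ hη hθ => simp only [map_add, LinearMap.add_apply, hη, hθ]

end Linear

/-! ### The isomorphism of Hodge structures `Gr^W_r(H^∨) ≅ (Gr^W_{-r} H)^∨` -/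

/-- Transport of the weight does not change Hodge numbers. [folklore] -/
private theorem cast_hodgeNumber {W' : Type u} [AddCommGroup W'] [Module ℚ W'] {n m : ℤ}
    (G : HodgeStructure W' n) (h : n = m) (p q : ℤ) : (G.cast h).hodgeNumber p q = G.hodgeNumber p q := by
  subst h
  rfl

/-- **`Gr^W_r(H^∨) ≅ (Gr^W_{-r} H)^∨` is a morphism of Hodge structures** of weight `r` (the target is the
dual Hodge structure of `Gr^W_{-r} H`, of weight `-(-r)`, transported to weight `r`): if
`[η] ∈ F^p Gr^W_r(H^∨)` with `η ∈ F^p(H^∨) ∩ W_r(H^∨)_ℂ = (F^{1-p})^⊥ ∩ …`, then `(dualGrMap)_ℂ [η]`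
kills `F^{1-p} Gr^W_{-r} H = image of F^{1-p} ∩ W_{-r,ℂ}` by `dualBaseChange_dualGrMap_baseChange`,
i.e. lies in `F^p((Gr^W_{-r} H)^∨) = (F^{1-p} Gr^W_{-r} H)^⊥`.  El Zein 1983, §II.0.2 (with Deligne,
Hodge II, 1.1.11 for the induced filtrations): `Gr^W_r(H^*) ≃ (Gr^W_{-r} H)^*` compatibly with `F`.
[cite: Elzein1983, §II.0.2] -/
def dualGrHom [HodgeTensorFacts.{u, u}] [FiniteDimensional ℚ V] (r : ℤ) :
    HodgeStructure.Hom (H.dual.gr r) (((H.gr (-r)).dual).cast (neg_neg r)) where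
  toLinearMap := H.dualGrMap r
  map_F_le p := by
    rintro _ ⟨ξ, hξ, rfl⟩
    rw [SetLike.mem_coe, gr_F, grF, Submodule.mem_map] at hξ
    obtain ⟨η, hη, rfl⟩ := hξ
    rw [Submodule.mem_comap, dual_F, Submodule.mem_comap, Submodule.mem_dualAnnihilator] at hη
    rw [HodgeStructure.cast_F, HodgeStructure.dual_F, HodgeStructure.mem_dualFiltration_iff]
    intro y hy
    rw [gr_F, grF, Submodule.mem_map] at hy
    obtain ⟨z, hz, rfl⟩ := hy
    rw [Submodule.mem_comap] at hz
    rw [dualBaseChange_dualGrMap_baseChange]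
    exact hη _ hz

/-- The underlying map of `dualGrHom` is `dualGrMap`. [cite: Elzein1983, §II.0.2] -/
@[simp]
theorem dualGrHom_toLinearMap [HodgeTensorFacts.{u, u}] [FiniteDimensional ℚ V] (r : ℤ) :
    (H.dualGrHom r).toLinearMap = H.dualGrMap r := rfl

/-- **`Gr^W_r(H^∨) ≅ (Gr^W_{-r} H)^∨` as Hodge structures**: the morphism `dualGrHom` is bijective
(so `HodgeStructure.Hom.inverse` gives the inverse morphism). [cite: Elzein1983, §II.0.2] -/
theorem dualGrHom_bijective [HodgeTensorFacts.{u, u}] [FiniteDimensional ℚ V] (r : ℤ) :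
    Function.Bijective (H.dualGrHom r).toLinearMap :=
  H.dualGrMap_bijective r

/-- **`h^{p,q}(Gr^W_r H^∨) = h^{p,q}((Gr^W_{-r} H)^∨)`**: the Hodge numbers of the graded pieces of the
dual MHS are those of the duals of the graded pieces (isomorphic Hodge structures,
`dualGrHom_bijective`). [cite: Elzein1983, §II.0.2] -/
theorem gr_dual_hodgeNumber [HodgeTensorFacts.{u, u}] [FiniteDimensional ℚ V] (r p q : ℤ) :
    (H.dual.gr r).hodgeNumber p q = (H.gr (-r)).dual.hodgeNumber p q := by
  rw [(H.dualGrHom r).hodgeNumber_eq_of_bijective (H.dualGrHom_bijective r) p q, cast_hodgeNumber]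

end MixedHodgeStructure

end Literature.AlgebraicGeometry.Motives

end
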